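import Mathlib

/-!
# `SnSubsetDichotomy.ThresholdSubsetTriples`, line `SketchIdeator2` — stub `stub_cayleyDeletion`, finite-core form

Crux `stmt-MatrixMultiplication-10882` (`Summit.MatrixMultiplication.MatrixMultiplication.Theses.SnSubsetDichotomy.
ThresholdSubsetTriples`), line `SketchIdeator2` (ℤ/3-triality), registered stub `stub_cayleyDeletion`
(Cayley-graph deletion): for finite `K, B ⊆ S_n` there is `X ⊆ K` avoiding `B` as a right quotient
(`x x'⁻¹ ∈ B ⇒ x = x'` for `x, x' ∈ X`) with `|K| ≤ (2|B| + 1)|X|`.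

This file proves the stub through its FINITE, GROUP-FREE CORE.  The only group theory in the statement
is the shape of the two neighbourhoods of a point `x` in the Cayley digraph of `B`:
the out-neighbourhood `N x = {x' | x x'⁻¹ ∈ B} = B⁻¹·x` and the in-neighbourhood
`M x = {k | k x⁻¹ ∈ B} = B·x`, both images of `B`, hence of size `≤ |B|`, and related by
`x ∈ N k → k ∈ M x`.  Everything else is the deletion lemma `core` for an ARBITRARY pair of
finite-set-valued maps `N, M` on a type with these two properties (out/in-degree `≤ d`): greedy
deletion — pick `x ∈ K`, delete the closed ball `{x} ∪ N x ∪ M x` (at most `2d + 1` points), recurse on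
the survivors (`Finset.strongInduction`), put `x` back.  The deletion order is the certificate: every
point of `K` is charged to the selected point whose ball deleted it, at most `2d + 1` per selected
point, so `|K| ≤ (2d + 1)|X|`; selected points are pairwise non-adjacent because a later pick survived
the balls of all earlier picks (`N`) and an earlier pick lies in no later ball by `x ∈ N k → k ∈ M x`.
`stub_cayleyDeletion` instantiates `N x := B.image (b ↦ b⁻¹ x)`, `M x := B.image (b ↦ b x)`, `d := |B|`
and translates `x x'⁻¹ ∈ B` into `x' ∈ N x` (witness `b := x x'⁻¹`).  (The statement quantifies over
all `n` and all finite `K, B`, so no `decide` closes it outright; the decidable content is the local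
ball count, discharged by `Finset.card_insert_le` / `card_union_le` / `card_image_le`.)

An independent proof of the same registered signature by a maximum-cardinality argument is
`Summit.MatrixMultiplication.MatrixMultiplication.Theorems.ThresholdSubsetTriples.stub_cayleyDeletion`
(file `SnSubsetDichotomyThresholdSubsetTriplesStubCayleyDeletion.lean`); this file lives in the
sub-namespace `CayleyDeletionK16` and imports nothing from it.  Deliberately NOT here: the host design
(`stub_blockedHosts`), twisted-corner freeness or the TPP transfer — other stubs of the line.
-/

namespace Summit.MatrixMultiplication.MatrixMultiplication.Theorems.ThresholdSubsetTriples.CayleyDeletionK16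

/-- **Finite core: greedy deletion in a digraph of out/in-degree `≤ d`.**  Let `N M : α → Finset α`
("out-" and "in-neighbourhoods") satisfy `x ∈ N k → k ∈ M x` and `|N x|, |M x| ≤ d` for all points.
Then every finite `K` contains an `N`-independent `X` (`x' ∈ N x ⇒ x = x'` on `X`) with
`|K| ≤ (2d + 1)|X|`.  Proof: strong induction on `K` — pick `x ∈ K`, delete the ball
`{x} ∪ N x ∪ M x` (`≤ 2d + 1` points, `Finset.card_le_card_sdiff_add_card`), apply the hypothesis to
the survivors and insert `x`. [folklore] -/
theorem core {α : Type*} [DecidableEq α] (N M : α → Finset α) (d : ℕ)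
    (hNM : ∀ x k, x ∈ N k → k ∈ M x) (hN : ∀ x, (N x).card ≤ d) (hM : ∀ x, (M x).card ≤ d)
    (K : Finset α) :
    ∃ X ⊆ K, (∀ x ∈ X, ∀ x' ∈ X, x' ∈ N x → x = x') ∧ K.card ≤ (2 * d + 1) * X.card := by
  induction K using Finset.strongInduction with
  | H K ih =>
    rcases K.eq_empty_or_nonempty with rfl | ⟨x, hx⟩
    · exact ⟨∅, Finset.Subset.refl _, by simp, by simp⟩
    · -- the closed ball of `x` and its three membership facts
      have hxD : x ∈ insert x (N x ∪ M x) := Finset.mem_insert_self _ _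
      have hND : ∀ k, k ∈ N x → k ∈ insert x (N x ∪ M x) := fun k hk =>
        Finset.mem_insert_of_mem (Finset.mem_union_left _ hk)
      have hMD : ∀ k, k ∈ M x → k ∈ insert x (N x ∪ M x) := fun k hk =>
        Finset.mem_insert_of_mem (Finset.mem_union_right _ hk)
      have hD : (insert x (N x ∪ M x)).card ≤ 2 * d + 1 :=
        calc (insert x (N x ∪ M x)).card ≤ (N x ∪ M x).card + 1 := Finset.card_insert_le _ _
          _ ≤ (N x).card + (M x).card + 1 := Nat.add_le_add_right (Finset.card_union_le _ _) 1
          _ ≤ d + d + 1 := Nat.add_le_add_right (Nat.add_le_add (hN x) (hM x)) 1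
          _ = 2 * d + 1 := by ring
      -- delete the ball and recurse on the survivors
      have hlt : K \ insert x (N x ∪ M x) ⊂ K :=
        (Finset.ssubset_iff_of_subset Finset.sdiff_subset).2
          ⟨x, hx, fun h => (Finset.mem_sdiff.1 h).2 hxD⟩
      obtain ⟨X', hX'K', hind', hcard'⟩ := ih _ hlt
      have hX'D : ∀ k ∈ X', k ∉ insert x (N x ∪ M x) := fun k hk =>
        (Finset.mem_sdiff.1 (hX'K' hk)).2
      have hxX' : x ∉ X' := fun h => hX'D x h hxD
      refine ⟨insert x X',
        Finset.insert_subset hx (hX'K'.trans Finset.sdiff_subset), ?_, ?_⟩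
      · -- independence: a bad pair must involve `x` and a survivor of its ball
        intro y hy y' hy' hyy'
        rcases Finset.mem_insert.1 hy with rfl | hyX'
        · rcases Finset.mem_insert.1 hy' with rfl | hy'X'
          · rfl
          · exact absurd (hND y' hyy') (hX'D y' hy'X')
        · rcases Finset.mem_insert.1 hy' with rfl | hy'X'
          · exact absurd (hMD y (hNM y' y hyy')) (hX'D y hyX')
          · exact hind' y hyX' y' hy'X' hyy'
      · -- counting: the ball is charged to `x`, the survivors to `X'`
        rw [Finset.card_insert_of_notMem hxX']
        calc K.card ≤ (K \ insert x (N x ∪ M x)).card + (insert x (N x ∪ M x)).card :=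
              Finset.card_le_card_sdiff_add_card
          _ ≤ (2 * d + 1) * X'.card + (2 * d + 1) := Nat.add_le_add hcard' hD
          _ = (2 * d + 1) * (X'.card + 1) := by ring

/-- **Stub `stub_cayleyDeletion` — Cayley-graph deletion** (registered stub of line `SketchIdeator2`,
crux `SnSubsetDichotomy.ThresholdSubsetTriples`, stmt-MatrixMultiplication-10882; finite-core form).
For finite `K, B ⊆ S_n` there is `X ⊆ K` with `x x'⁻¹ ∈ B ⇒ x = x'` on `X` and
`|K| ≤ (2|B| + 1)|X|`.  Proof: `core` for the Cayley digraph of `B` — out-neighbourhoods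
`N x := B.image (b ↦ b⁻¹ x)` (so `x x'⁻¹ ∈ B ⇒ x' ∈ N x` with `b := x x'⁻¹`), in-neighbourhoods
`M x := B.image (b ↦ b x)` (so `x ∈ N k ⇒ k ∈ M x`), both of size `≤ |B|`
(`Finset.card_image_le`). [folklore] -/
theorem stub_cayleyDeletion : ∀ (n : ℕ) (K B : Finset (Equiv.Perm (Fin n))), ∃ X ⊆ K, (∀ x ∈ X, ∀ x' ∈ X, x * x'⁻¹ ∈ B → x = x') ∧ K.card ≤ (2 * B.card + 1) * X.card := by
  intro n K B
  obtain ⟨X, hXK, hind, hcard⟩ :=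
    core (fun x => B.image (fun b => b⁻¹ * x)) (fun x => B.image (fun b => b * x)) B.card
      (fun x k hxk => by
        obtain ⟨b, hb, hbk⟩ := Finset.mem_image.1 hxk
        exact Finset.mem_image.2 ⟨b, hb, (inv_mul_eq_iff_eq_mul.1 hbk).symm⟩)
      (fun _ => Finset.card_image_le) (fun _ => Finset.card_image_le) K
  refine ⟨X, hXK, fun x hx x' hx' hB => hind x hx x' hx' ?_, hcard⟩
  exact Finset.mem_image.2 ⟨x * x'⁻¹, hB, by simp⟩

end Summit.MatrixMultiplication.MatrixMultiplication.Theorems.ThresholdSubsetTriples.CayleyDeletionK16
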